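import Literature.AlgebraicGeometry.HodgeTheory.DirectImageEndomorphism
import Literature.AlgebraicGeometry.HodgeTheory.FibrewiseDeckRelations
import Literature.AlgebraicGeometry.HodgeTheory.AlgebraicMonodromyMumfordTate
import Literature.AlgebraicGeometry.HodgeTheory.RelativeHyperplaneClassHodgeRiemann
import Literature.AlgebraicGeometry.HodgeTheory.PolarizationFormMonodromyInvariant
import Literature.AlgebraicGeometry.HodgeTheory.BettiUniverseKunnethHodgePowersNormalForm
import Literature.AlgebraicGeometry.HodgeTheory.BettiUniverseAxioms
import HarnessLib

/-!
# Route `Q8SymplecticPowers`, crux K1Q «mechanism-v3» — glue S7, geometric bricks G1–G2: the rational monodromy of a smooth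
# projective family COMMUTES with the fibre maps of an endomorphism over the base, and PRESERVES the cup product into the
# top degree (hence the trace form `tr(x ∪ y)`)

Support file for crux K1Q (stmt-HodgeConjecture-24190; `--supports … --as helper`; nothing here closes an item). Prover seat
`hodge-nonav-19716-p2` (g14), owner of stub S7 `stub_transportHeredityQ`. In the POINT CURRENCY of the registered stubs S4 ∕ S5 ∕ S7
(`Xs := fiberOver π s`, `A := pull (fiberOverEnd π τ hτπ s) 2`, `Qf := tr ∘ cup`, `Γ := ratMonodromyGroup π 2 hU s`) these are the
hypotheses `hΓA`, `hΓB`, `hΓQ` of the restriction-currency theorem `mem_glIdentityComponent_of_variablePart`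
(`Q8SymplecticPowersTransportRestrictionCurrency`):

* `apply_pull_fiberOverEnd_of_mem_ratMonodromyGroup` (G1) — for ANY family `π : 𝒳 ⟶ S` cohomologically locally trivial over
  `S(ℂ)`, an endomorphism `τ` of `𝒳` over `S` and `g ∈ Γ_s` (degree `k`): `g (τ_s^* x) = τ_s^* (g x)` — the pull-back
  `τ^* : Rᵏ π_* ℚ → Rᵏ π_* ℚ` is a morphism of local systems (`transportFun_map_fiberHom`, Voisin II §3.1.2), read on rational
  transports through the injective complexification `ofRatClass`.
* `cup_apply_apply_of_mem_ratMonodromyGroup` (G2) — for a smooth projective family of SURFACES with quasi-projective total space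
  over a quasi-projective base and `g ∈ Γ_s` (degree `2`): `g x ∪ g y = x ∪ y` in `H⁴(X_s; ℚ)` — transport is multiplicative
  (`transportFun_cupProduct`) and acts trivially on the top cohomology (`transportFun_eq_self_of_top`, through the relative
  hyperplane class with hard Lefschetz on the fibre, `exists_global_polarizationForm_rational_pos`).
* `tr_cup_apply_apply_of_mem_ratMonodromyGroup` — hence `tr(g x ∪ g y) = tr(x ∪ y)`: `Γ_s ⊆ O(Qf)`.

HONEST FRAMING: bookkeeping over tree theorems (axioms standard, no named fact); K1Q ∕ HC ∕ HC_AV NOT proved; item 24190 OPEN.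

## References
* [VoisinHodgeII2003] C. Voisin, Hodge Theory and Complex Algebraic Geometry II, CUP 2003, §3.1.2 (local systems `Rᵏ π_* A`).
* [VoisinHodgeI2002] C. Voisin, Hodge Theory and Complex Algebraic Geometry I, CUP 2002, Thm. 6.25, §7.1.2.
* [CarlsonMullerStachPeters2017] J. Carlson, S. Müller-Stach, C. Peters, Period Mappings and Period Domains, 2nd ed., Lemma–Def. 15.3.7.
-/

noncomputable section

set_option linter.dupNamespace false

namespace Summit.HodgeConjecture.HodgeConjecture.Theorems.Q8SymplecticPowersMonodromyDeckCommutes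

open CategoryTheory CategoryTheory.Limits AlgebraicGeometry
open Literature.AlgebraicGeometry.Motives Literature.AlgebraicGeometry.HodgeTheory
open Literature.AlgebraicGeometry.HodgeTheory.BettiUniverse
open Literature.AlgebraicTopology.SingularHomology

/-! ### G1 — monodromy commutes with the fibre maps of an endomorphism over the base -/

/-- **G1.** `π : 𝒳 ⟶ S` cohomologically locally trivial over `S(ℂ)` (`hU`), `τ : 𝒳 ⟶ 𝒳` with `τ ≫ π = π`, `s ∈ S(ℂ)`,
`g ∈ Γ_s = ratMonodromyGroup π k hU s`. Then `g` commutes with `τ_s^* = pull (fiberOverEnd π τ hτ s) k` on `Hᵏ(X_s; ℚ)`.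
[cite: VoisinHodgeII2003, §3.1.2] -/
theorem apply_pull_fiberOverEnd_of_mem_ratMonodromyGroup {𝒳 S : SchemeOver ℂ} (π : 𝒳 ⟶ S) (k : ℕ)
    (hU : IsCohomologicallyLocallyTrivialOn π (Set.univ : Set (ComplexPoints S))) (τ : 𝒳 ⟶ 𝒳) (hτ : τ ≫ π = π)
    (s : ComplexPoints S) {g : bettiCohomology (fiberOver π s) k ≃ₗ[ℚ] bettiCohomology (fiberOver π s) k}
    (hg : g ∈ ratMonodromyGroup π k hU ⟨s, Set.mem_univ s⟩) (x : bettiCohomology (fiberOver π s) k) :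
    g (pull (fiberOverEnd π τ hτ s) k x) = pull (fiberOverEnd π τ hτ s) k (g x) := by
  obtain ⟨γ, hγ⟩ := (mem_ratMonodromyGroup_iff π k hU ⟨s, Set.mem_univ s⟩ g).1 hg
  apply ofRatClass_injective
  rw [hγ, ofRatClass_pull, ofRatClass_pull, hγ]
  exact transportFun_map_fiberHom π k hU τ hτ (fun t => fiberOverEnd π τ hτ t) (fun t => fiberOverEnd_comp_fiberι π τ hτ t)
    γ _

/-! ### G2 — monodromy preserves the cup product into the top degree (surfaces) -/

/-- **G2.** `π : 𝒳 ⟶ S` a smooth projective family of surfaces with `𝒳` and `S` quasi-projective, cohomologically locally trivial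
over `S(ℂ)` (`hU`), `s ∈ S(ℂ)`, `g ∈ Γ_s` in degree `2`. Then `g x ∪ g y = x ∪ y` in `H⁴(X_s; ℚ)` for all `x, y ∈ H²(X_s; ℚ)`.
[cite: VoisinHodgeII2003, §3.1.2] [cite: VoisinHodgeI2002, Thm. 6.25 and §7.1.2] -/
theorem cup_apply_apply_of_mem_ratMonodromyGroup {𝒳 S : SchemeOver ℂ} (π : 𝒳 ⟶ S) (hπ : IsSmoothProjectiveFamily π 2)
    (h𝒳 : IsQuasiProjectiveOver 𝒳) (hS : IsQuasiProjectiveOver S)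
    (hU : IsCohomologicallyLocallyTrivialOn π (Set.univ : Set (ComplexPoints S))) (s : ComplexPoints S)
    {g : bettiCohomology (fiberOver π s) 2 ≃ₗ[ℚ] bettiCohomology (fiberOver π s) 2}
    (hg : g ∈ ratMonodromyGroup π 2 hU ⟨s, Set.mem_univ s⟩) (x y : bettiCohomology (fiberOver π s) 2) :
    cup (fiberOver π s) 2 2 (g x) (g y) = cup (fiberOver π s) 2 2 x y := by
  obtain ⟨γ, hγ⟩ := (mem_ratMonodromyGroup_iff π 2 hU ⟨s, Set.mem_univ s⟩ g).1 hg
  haveI : IsSeparated S.hom := IsQuasiProjectiveOver.isSeparated hS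
  obtain ⟨K, hL, -, -, -⟩ := exists_global_polarizationForm_rational_pos π 2 1 hπ h𝒳 s
  apply ofRatClass_injective
  change ofRatClass _ (2 + 2) (bettiCup rfl (g x) (g y)) = ofRatClass _ (2 + 2) (bettiCup rfl x y)
  rw [ofRatClass_bettiCup, ofRatClass_bettiCup, hγ, hγ]
  -- transport is multiplicative and trivial on `H⁴` (degree written `2 * 2`; the goal, in degree `2 + 2`, is the same term)
  have h1 := transportFun_cupProduct π hU (show 2 + 2 = 2 * 2 from rfl) γ (ofRatClass _ 2 x) (ofRatClass _ 2 y)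
  have h2 := transportFun_eq_self_of_top π hU K (n := 2) (s := ⟨s, Set.mem_univ s⟩) (hπ.isSmoothProjective s) hL γ
    (cupProduct (show 2 + 2 = 2 * 2 from rfl) (ofRatClass _ 2 x) (ofRatClass _ 2 y))
  exact h1.symm.trans h2

/-- **G2, trace form.** Same hypotheses: `tr(g x ∪ g y) = tr(x ∪ y)` — every monodromy transformation of `R² π_* ℚ` is an isometry
of the trace form `Qf = tr ∘ cup` of the registered stubs (`Γ_s ⊆ O(Qf)`). [cite: VoisinHodgeII2003, §3.1.2] -/
theorem tr_cup_apply_apply_of_mem_ratMonodromyGroup {𝒳 S : SchemeOver ℂ} (π : 𝒳 ⟶ S) (hπ : IsSmoothProjectiveFamily π 2)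
    (h𝒳 : IsQuasiProjectiveOver 𝒳) (hS : IsQuasiProjectiveOver S)
    (hU : IsCohomologicallyLocallyTrivialOn π (Set.univ : Set (ComplexPoints S))) (s : ComplexPoints S)
    {g : bettiCohomology (fiberOver π s) 2 ≃ₗ[ℚ] bettiCohomology (fiberOver π s) 2}
    (hg : g ∈ ratMonodromyGroup π 2 hU ⟨s, Set.mem_univ s⟩) (x y : bettiCohomology (fiberOver π s) 2) :
    tr (hπ.isSmoothProjective s) (2 + 2) (cup (fiberOver π s) 2 2 (g x) (g y)) =
      tr (hπ.isSmoothProjective s) (2 + 2) (cup (fiberOver π s) 2 2 x y) := by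
  rw [cup_apply_apply_of_mem_ratMonodromyGroup π hπ h𝒳 hS hU s hg]

end Summit.HodgeConjecture.HodgeConjecture.Theorems.Q8SymplecticPowersMonodromyDeckCommutes

end
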